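import Summits.KontsevichZagierPeriods.Zeta5Search.LaiSweepShard

/-!
# `κ₃` sweep certificate — shard file 103 of 127 (shards 721–727 of 889)

HONEST FRAMING. Systematic search; no irrationality claim unless certified. This file only checks,
by `decide +kernel`, shards 721–727 of the order-cell sweep of the `κ₃` point `(74, 2180, 444; δ74)`
(engine `LaiSweepEngine`, soundness `LaiSweepJump/Free/Eval/Shard/Kappa3`; a shard is `⟨regime, n,
p, q, p', q', Lo, Up⟩`: `n` cells from `p/q` to `p'/q'` with integer rate sums in `[Lo, Up]`, `K =
128`, `D = 2^40`). It draws NO conclusion: only the capstone `LaiKappa3SweepCert`, which needs all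
127 shard files, does. Kernel cost of this file ≈ 560 cells × 0.3 s.
-/

namespace Summit.KontsevichZagierPeriods.Zeta5Search.Sweep

set_option maxHeartbeats 100000000 in
/-- Shard 721: 80 cells of regime B from `247/313` to `347/439`.
[cite: Lai2024BallRivoal, §4 Lemma 4.3] -/
theorem shard721 :
    Shard.check 128 (2^40)
      ⟨true, 80, 247, 313, 347, 439, 11564836032909, 17825274219669⟩ = true := by
  decide +kernel

set_option maxHeartbeats 100000000 in
/-- Shard 722: 80 cells of regime B from `347/439` to `19/24`.
[cite: Lai2024BallRivoal, §4 Lemma 4.3] -/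
theorem shard722 :
    Shard.check 128 (2^40)
      ⟨true, 80, 347, 439, 19, 24, 11001999857494, 16975633432211⟩ = true := by
  decide +kernel

set_option maxHeartbeats 100000000 in
/-- Shard 723: 80 cells of regime B from `19/24` to `157/198`.
[cite: Lai2024BallRivoal, §4 Lemma 4.3] -/
theorem shard723 :
    Shard.check 128 (2^40)
      ⟨true, 80, 19, 24, 157, 198, 11254197914147, 17382932369752⟩ = true := by
  decide +kernel

set_option maxHeartbeats 100000000 in
/-- Shard 724: 80 cells of regime B from `157/198` to `274/345`.
[cite: Lai2024BallRivoal, §4 Lemma 4.3] -/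
theorem shard724 :
    Shard.check 128 (2^40)
      ⟨true, 80, 157, 198, 274, 345, 11343570992129, 17539615086788⟩ = true := by
  decide +kernel

set_option maxHeartbeats 100000000 in
/-- Shard 725: 80 cells of regime B from `274/345` to `311/391`.
[cite: Lai2024BallRivoal, §4 Lemma 4.3] -/
theorem shard725 :
    Shard.check 128 (2^40)
      ⟨true, 80, 274, 345, 311, 391, 10618061917296, 16434715668586⟩ = true := by
  decide +kernel

set_option maxHeartbeats 100000000 in
/-- Shard 726: 80 cells of regime B from `311/391` to `239/300`.
[cite: Lai2024BallRivoal, §4 Lemma 4.3] -/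
theorem shard726 :
    Shard.check 128 (2^40)
      ⟨true, 80, 311, 391, 239, 300, 11293552803437, 17498301801955⟩ = true := by
  decide +kernel

set_option maxHeartbeats 100000000 in
/-- Shard 727: 80 cells of regime B from `239/300` to `304/381`.
[cite: Lai2024BallRivoal, §4 Lemma 4.3] -/
theorem shard727 :
    Shard.check 128 (2^40)
      ⟨true, 80, 239, 300, 304, 381, 10949994827022, 16983740729211⟩ = true := by
  decide +kernel

/-- The checked shards of this file, in order. [folklore] -/
def shards103 : List (CheckedShard 128 (2^40)) :=
  [⟨_, shard721⟩, ⟨_, shard722⟩, ⟨_, shard723⟩, ⟨_, shard724⟩, ⟨_, shard725⟩,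
    ⟨_, shard726⟩, ⟨_, shard727⟩]

end Summit.KontsevichZagierPeriods.Zeta5Search.Sweep
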